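import Mathlib
import Summits.Ventures.DiscreteObjects.Mahler.CensusKernelDeg20C1
import Summits.Ventures.DiscreteObjects.Mahler.CensusKernelDeg20C2
import Summits.Ventures.DiscreteObjects.Mahler.CensusKernelDeg20NL1
import Summits.Ventures.DiscreteObjects.Mahler.CensusKernelDeg20NL2
import Summits.Ventures.DiscreteObjects.Mahler.CensusKernelDeg20NL3
import Summits.Ventures.DiscreteObjects.Mahler.CensusKernelDeg20NL4
import Summits.Ventures.DiscreteObjects.Mahler.CensusKernelDeg20NL5

/-!
# Kernel census, degree 20 (part Final): assembly — the census row of degree 20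

Cell `pub-namedobj`, seat `pub-namedobj-mahler-g16`. Framing: lottery ticket; floor = certified bounds/negative ranges.

Part of the kernel proof of `DegreeCensus 20 (13/10) coresDeg20` (see part A for the method: census search with
Toeplitz/resultant cuts, kernel-certified explicit-auxiliary-function cuts and certified leaf thresholds; 823081 leaves
with `c_1 >= 0`, 143927 survivors certified by extended certificates `CertX`: base red/cyc/exc or trace-Graeffe `tgr`).
This part holds, for the search nodes listed below, one kernel check each (`decide` with kernel reduction, standard axioms;
nodes costing more than the per-theorem budget are split by the next coefficient and re-assembled by a node lemma).
CONTROL/replication of the published degree-20 list (Boyd 1980/1989; Mossinghoff 1998; Mossinghoff-Rhin-Wu 2008), not new ground.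
-/

namespace Summit.Ventures.DiscreteObjects.Mahler

open Polynomial

/-- Every survivor with `c₁ ≥ 0` of the degree-20 search (with cuts) is certified. -/
theorem certified20 : ∀ a ∈ censusSearchC T20 CT20 10 [] [], 0 ≤ a.getD 0 0 →
    ∃ c, checkCertX 13 10 10 coresDeg20 LC20 (1 :: palC a) c = true := by
  intro a ha hsign
  rw [show censusSearchC T20 CT20 10 [] [] = censusSearchC T20 CT20 10 [] (psumsRev [] 0) from rfl,
    mem_censusSearchC_node_iff (pre := []) (n := 0) rfl, (by decide +kernel : nodeLoC T20 CT20 [] (psumsRev [] 0) = -2),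
    (by decide +kernel : nodeHiC T20 CT20 [] (psumsRev [] 0) = 2)] at ha
  obtain ⟨a1, ha1, ha⟩ := ha
  simp only [List.nil_append, Nat.reduceAdd] at ha
  rw [getD_zero_of_mem_censusSearchC_cons ha] at hsign
  rw [mem_icc] at ha1
  obtain ⟨hlo1, hhi1⟩ := ha1
  interval_cases a1
  · rw [mem_censusSearchC_node_iff (pre := [0]) (n := 1) rfl,
      (by decide +kernel : nodeLoC T20 CT20 [0] (psumsRev [0] 1) = -2),
      (by decide +kernel : nodeHiC T20 CT20 [0] (psumsRev [0] 1) = 2)] at ha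
    obtain ⟨a2, ha2, ha⟩ := ha
    simp only [List.cons_append, List.nil_append, Nat.reduceAdd] at ha
    rw [mem_icc] at ha2
    obtain ⟨hlo2, hhi2⟩ := ha2
    interval_cases a2
    · exact certified20n_p0_m2 a ha
    · exact certified20n_p0_m1 a ha
    · exact certified20n_p0_p0 a ha
    · exact certified20n_p0_p1 a ha
    · exact certified20n_p0_p2 a ha
  · rw [mem_censusSearchC_node_iff (pre := [1]) (n := 1) rfl,
      (by decide +kernel : nodeLoC T20 CT20 [1] (psumsRev [1] 1) = -1),
      (by decide +kernel : nodeHiC T20 CT20 [1] (psumsRev [1] 1) = 2)] at ha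
    obtain ⟨a2, ha2, ha⟩ := ha
    simp only [List.cons_append, List.nil_append, Nat.reduceAdd] at ha
    rw [mem_icc] at ha2
    obtain ⟨hlo2, hhi2⟩ := ha2
    interval_cases a2
    · exact certified20n_p1_m1 a ha
    · exact certified20n_p1_p0 a ha
    · exact certified20n_p1_p1 a ha
    · exact certified20n_p1_p2 a ha
  · rw [mem_censusSearchC_node_iff (pre := [2]) (n := 1) rfl,
      (by decide +kernel : nodeLoC T20 CT20 [2] (psumsRev [2] 1) = 0),
      (by decide +kernel : nodeHiC T20 CT20 [2] (psumsRev [2] 1) = 4)] at ha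
    obtain ⟨a2, ha2, ha⟩ := ha
    simp only [List.cons_append, List.nil_append, Nat.reduceAdd] at ha
    rw [mem_icc] at ha2
    obtain ⟨hlo2, hhi2⟩ := ha2
    interval_cases a2
    · exact certified20n_p2_p0 a ha
    · exact certified20n_p2_p1 a ha
    · exact certified20n_p2_p2 a ha
    · exact certified20n_p2_p3 a ha
    · exact certified20n_p2_p4 a ha

/-- **Degree-20 census below `13/10` (kernel theorem):** `DegreeCensus 20 (13/10) coresDeg20` — every irreducible
`P ∈ ℤ[X]` of degree `20` with `1 < M(P) < 13/10` is `± c(± x)` for one of the 49 census cores of `coresDeg20`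
(the published complete degree-20 list, re-derived inside the kernel: CONTROL/replication row). -/
theorem degreeCensus_twenty : DegreeCensus 20 (13 / 10) coresDeg20 := by
  have h := degreeCensus_of_certified_nonnegXC (Bn := 13) (Bd := 10) (d := 10) (by norm_num) (by norm_num) (by norm_num)
    (by decide) thresholdsValidX_T20 cutTableValidX_CT20 leafCutsValid_LC20 (by have := smythTheta_gt; push_cast; linarith)
    certified20
  norm_num at h
  exact h

end Summit.Ventures.DiscreteObjects.Mahler
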